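import Mathlib.RingTheory.Ideal.Operations
import Mathlib.RingTheory.Ideal.Maps
import Mathlib.RingTheory.Jacobson.Ideal
import HarnessLib

/-!
# The divisorial monoid of an ideal (stalks of the log structure of a boundary divisor)

Topic: `Literature/AlgebraicGeometry/Resolution`. For a commutative ring `A` and an ideal
`I ⊆ A` — in the applications `A = 𝒪_{X,x}` and `I` the stalk of the ideal of a (boundary)
divisor `D` — the **divisorial monoid** of `I` is the submonoid

  `divisorialMonoid I = {g ∈ A | I ⊆ √(g)}`

of elements `g` every prime containing which contains `I`; for `A = 𝒪_{X,x}` on a locally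
Noetherian scheme these are exactly the germs that are invertible at every generisation of `x`
outside `V(I) = D`, i.e. the stalk at `x` of the log structure
`M_D = 𝒪_X ∩ j_* 𝒪^*_{X ∖ D}` of the divisor `D` (Kato 1994, (1.5) example and Thm. 11.6;
Nizioł 2006, §2.1). It contains the units (`= ` the units when `I = ⊤`: the trivial log
structure), is monotone decreasing in `I`, depends on `I` only through its radical, and is
generated — when `I = (x₁ ⋯ x_r)` for prime elements `x_j` of a unique factorisation domain — by
the units and the `x_j` (not proved here).

This is the family of stalk monoids one PRESCRIBES when gluing local fs charts into a
log-regular atlas for the log structure of a boundary (`LocalLogRegularChart X M x`,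
`logRegularAtlas_of_localLogRegularChart` in `LogRegularAtlasGluing.lean`).

* `divisorialMonoid I` — the definition;
* `mem_divisorialMonoid_iff` (`rfl` lemma), `isUnit_mem_divisorialMonoid`,
  `mem_divisorialMonoid_iff_forall_isPrime` (prime-avoidance form),
  `divisorialMonoid_top` (`I = ⊤`: exactly the units), `divisorialMonoid_anti` (monotonicity),
  `divisorialMonoid_radical` (depends only on `√I`), `mem_divisorialMonoid_of_dvd_pow`
  (if `I = (x)` then every divisor of a power of `x` belongs to it).

What is NOT here: no sheaf `M_D`, no comparison with `j_* 𝒪^*`, no statement about generation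
by prime elements.

Sources: [Kato1994] K. Kato, *Toric singularities*, Amer. J. Math. 116 (1994), (1.5) and
Thm. 11.6. [Niziol2006] W. Nizioł, *Toric singularities: log-blow-ups and global resolutions*,
J. Algebraic Geom. 15 (2006), §2.1.
-/

namespace Literature.AlgebraicGeometry.Resolution

variable {A : Type*} [CommRing A]

/-- The **divisorial monoid** of an ideal `I ⊆ A`: the elements `g` with `I ⊆ √(g)`, i.e. such
that every prime ideal containing `g` contains `I` — for `A = 𝒪_{X,x}` and `I` the stalk of the
ideal of a divisor `D`, the germs invertible off `D`, the stalk of Kato's log structure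
`𝒪_X ∩ j_* 𝒪^*_{X∖D}`. [cite: Kato1994, (1.5) and Thm. 11.6] -/
def divisorialMonoid (I : Ideal A) : Submonoid A where
  carrier := {g | I ≤ (Ideal.span {g}).radical}
  one_mem' := by
    simp only [Set.mem_setOf_eq, Ideal.span_singleton_one, Ideal.radical_top]
    exact le_top
  mul_mem' := by
    intro a b ha hb
    simp only [Set.mem_setOf_eq] at ha hb ⊢
    rw [← Ideal.span_singleton_mul_span_singleton, Ideal.radical_mul]
    exact le_inf ha hb

/-- Membership in the divisorial monoid (`rfl`). [folklore] -/
theorem mem_divisorialMonoid_iff {I : Ideal A} {g : A} :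
    g ∈ divisorialMonoid I ↔ I ≤ (Ideal.span {g}).radical :=
  Iff.rfl

/-- Units belong to every divisorial monoid. [folklore] -/
theorem isUnit_mem_divisorialMonoid (I : Ideal A) {g : A} (hg : IsUnit g) :
    g ∈ divisorialMonoid I := by
  rw [mem_divisorialMonoid_iff, (Ideal.span_singleton_eq_top.mpr hg), Ideal.radical_top]
  exact le_top

/-- **Prime-avoidance form**: `g ∈ divisorialMonoid I` iff every prime ideal containing `g`
contains `I` (for `A = 𝒪_{X,x}`: `g` vanishes only at generisations of `x` lying on `V(I)`).
[folklore] -/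
theorem mem_divisorialMonoid_iff_forall_isPrime {I : Ideal A} {g : A} :
    g ∈ divisorialMonoid I ↔ ∀ 𝔭 : Ideal A, 𝔭.IsPrime → g ∈ 𝔭 → I ≤ 𝔭 := by
  rw [mem_divisorialMonoid_iff, Ideal.radical_eq_sInf, le_sInf_iff]
  constructor
  · intro h 𝔭 h𝔭 hg
    exact h 𝔭 ⟨(Ideal.span_singleton_le_iff_mem _).mpr hg, h𝔭⟩
  · rintro h 𝔭 ⟨hg𝔭, h𝔭⟩
    exact h 𝔭 h𝔭 ((Ideal.span_singleton_le_iff_mem _).mp hg𝔭)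

/-- For `I = ⊤` (no boundary) the divisorial monoid is the group of units — the trivial log
structure. [cite: Kato1994, (2.2)(1)] -/
theorem divisorialMonoid_top : divisorialMonoid (⊤ : Ideal A) = IsUnit.submonoid A := by
  ext g
  rw [mem_divisorialMonoid_iff, top_le_iff, Ideal.radical_eq_top, Ideal.span_singleton_eq_top]
  rfl

/-- The divisorial monoid is antitone in the ideal: a larger boundary allows more elements.
[folklore] -/
theorem divisorialMonoid_anti {I J : Ideal A} (h : I ≤ J) : divisorialMonoid J ≤ divisorialMonoid I :=
  fun _ hg => le_trans h hg

/-- The divisorial monoid depends on the ideal only through its radical (only the support of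
the boundary matters). [folklore] -/
theorem divisorialMonoid_radical (I : Ideal A) : divisorialMonoid I.radical = divisorialMonoid I := by
  ext g
  simp only [mem_divisorialMonoid_iff]
  exact ⟨fun h => le_trans Ideal.le_radical h, fun h => Ideal.radical_le_radical_iff.mpr h⟩

/-- If `x ∈ √I`-generates in the sense `I ≤ √(x)` — in particular if `I = (x)` — then every
divisor of a power of `x` lies in the divisorial monoid (the monomials in the boundary
equations and their divisors). [folklore] -/
theorem mem_divisorialMonoid_of_dvd_pow {I : Ideal A} {x g : A} (hx : I ≤ (Ideal.span {x}).radical)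
    {n : ℕ} (hg : g ∣ x ^ n) : g ∈ divisorialMonoid I := by
  rw [mem_divisorialMonoid_iff]
  refine le_trans hx (Ideal.radical_le_radical_iff.mpr ?_)
  rw [Ideal.span_singleton_le_iff_mem]
  exact ⟨n, Ideal.mem_span_singleton.mpr hg⟩

/-- In particular the generator itself: `x ∈ divisorialMonoid (x)`. [folklore] -/
theorem mem_divisorialMonoid_span_singleton_self (x : A) :
    x ∈ divisorialMonoid (Ideal.span {x}) :=
  mem_divisorialMonoid_of_dvd_pow Ideal.le_radical (n := 1) (by rw [pow_one])

end Literature.AlgebraicGeometry.Resolution
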